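import Summits.BirchSwinnertonDyer.BirchSwinnertonDyer.Theorems.GoldfeldAllTwistsTwoConverseTwinAdditiveTwoAdicThreeModEightPOne
import Summits.BirchSwinnertonDyer.BirchSwinnertonDyer.Theorems.GoldfeldAllTwistsTwoConverseTwinAdditiveTwoPrimesTwistSelmerPOne
import HarnessLib

set_option linter.dupNamespace false -- namespace `…BirchSwinnertonDyer.BirchSwinnertonDyer…` is the cell's (D-0017 nested layout)
set_option autoImplicit false

/-!
# B5⁺ tranche F_β⁺, file Fβ⁺-0c: `…TwinAdditiveTwoAdicDualThreeModEightPFive` — the `2`-adic kills of the classes `−q, 7q, −2qp, 14qp` of the DUAL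
# Selmer set `S′ = S(84qp, −28q²p²)` on `(q, p) ≡ (3, 5) (mod 8)` (TYPE-FREE, `(p/q)`-free)

Cell `bsd-goldfeld`, seat `bsd-goldfeld-s1p-c3x` (gen 16); planner ORDER (cccxciii) «OBJECT B5⁺», tranche F_β⁺ (kill table `scoping/kills_b35_plus.txt`: on b35+
the classes `−q, 7q, −2qp, 14qp` of `S′(W)` die ONLY at `2`). The `(3, 5)` companion of C5-F's T0′ `…TwinAdditiveTwoAdicThreeModEightPOne` (`(3, 1)`):
* `−2qp, 14qp`: common factor `qp ≡ 7 (mod 8)`, `qp ↦ −1`, onto C7-F9a's normalised numeric `(−84; 2, −14)` (`not_isSoluble_two_normalised_pOne`) and its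
  `u ↔ z` swap (`isSoluble_map_twoIsogenyQuartic_comm`);
* `−q, 7q`: square factor `p ↦ 5` then common factor `q ↦ 3`, onto the NEW numerics `(1260; −3, 2100)` and `(1260; 21, −300)`, both charts dying modulo `2⁵`
  (`decide`).
`--supports stmt-BirchSwinnertonDyer-19140` as a HELPER. Theses-free; theorems only; no definition, no fact binder, no `sorry`. FRONTIER-grade: a twist-density-ZERO
sub-family; never distance-to-summit. HONEST FRAMING: local lemmas only; no Selmer group is bounded in this file; items 19140 / 19350 / 20044 unchanged;
BSD is not proved by any of this.

References: [SilvermanAEC2009] Prop. X.4.9, Example X.4.10; [Serre1973] Ch. II §3.3 Thm 4.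
-/

noncomputable section

open scoped Classical

open WeierstrassCurve Literature.NumberTheory.EllipticCurves

namespace Summit.BirchSwinnertonDyer.BirchSwinnertonDyer.Theorems.GoldfeldGoodTwists

/-! ## §1 The two numeric quartics die modulo `2⁵` in both charts -/

/-- `ℤ/2⁵` keys for `(1260; −3, 2100)`: both charts die modulo `32`. [folklore] -/
private theorem keys_threeFive_negQ :
    (∀ T S : ZMod (2 ^ 5), S ^ 2 ≠ ((-3 : ℤ) : ZMod (2 ^ 5)) + ((1260 : ℤ) : ZMod (2 ^ 5)) * T ^ 2 +
      ((2100 : ℤ) : ZMod (2 ^ 5)) * T ^ 4) ∧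
    (∀ T S : ZMod (2 ^ 5), S ^ 2 ≠ ((2100 : ℤ) : ZMod (2 ^ 5)) + ((1260 : ℤ) : ZMod (2 ^ 5)) * T ^ 2 +
      ((-3 : ℤ) : ZMod (2 ^ 5)) * T ^ 4) := by
  refine ⟨?_, ?_⟩ <;> decide +kernel

/-- `ℤ/2⁵` keys for `(1260; 21, −300)`: both charts die modulo `32`. [folklore] -/
private theorem keys_threeFive_sevenQ :
    (∀ T S : ZMod (2 ^ 5), S ^ 2 ≠ ((21 : ℤ) : ZMod (2 ^ 5)) + ((1260 : ℤ) : ZMod (2 ^ 5)) * T ^ 2 +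
      ((-300 : ℤ) : ZMod (2 ^ 5)) * T ^ 4) ∧
    (∀ T S : ZMod (2 ^ 5), S ^ 2 ≠ ((-300 : ℤ) : ZMod (2 ^ 5)) + ((1260 : ℤ) : ZMod (2 ^ 5)) * T ^ 2 +
      ((21 : ℤ) : ZMod (2 ^ 5)) * T ^ 4) := by
  refine ⟨?_, ?_⟩ <;> decide +kernel

/-- **Numeric kill `(1260; −3, 2100)`**: `w² = −3u⁴ + 1260u²z² + 2100z⁴` has no non-trivial `ℚ₂`-point (both charts die modulo `2⁵`).
[cite: SilvermanAEC2009, Prop. X.4.9 and Example X.4.10] -/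
theorem not_isSoluble_two_normalised_negQ_threeFive :
    ¬ ((twoIsogenyQuartic 1260 (-3) 2100).map (Int.castRingHom ℚ_[2])).IsSoluble := by
  obtain ⟨c, c'⟩ := keys_threeFive_negQ
  exact not_isSoluble_two_of_padicInt_charts (padicInt_two_sq_ne_of_zmodPow 5 c) (padicInt_two_sq_ne_of_zmodPow 5 c')

/-- **Numeric kill `(1260; 21, −300)`**: `w² = 21u⁴ + 1260u²z² − 300z⁴` has no non-trivial `ℚ₂`-point (both charts die modulo `2⁵`).
[cite: SilvermanAEC2009, Prop. X.4.9 and Example X.4.10] -/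
theorem not_isSoluble_two_normalised_sevenQ_threeFive :
    ¬ ((twoIsogenyQuartic 1260 21 (-300)).map (Int.castRingHom ℚ_[2])).IsSoluble := by
  obtain ⟨c, c'⟩ := keys_threeFive_sevenQ
  exact not_isSoluble_two_of_padicInt_charts (padicInt_two_sq_ne_of_zmodPow 5 c) (padicInt_two_sq_ne_of_zmodPow 5 c')

/-! ## §2 The four classes `−q, 7q, −2qp, 14qp` of `S′ = S(84qp, −28q²p²)` at `(q, p) ≡ (3, 5) (mod 8)` -/

section Classes
variable {q p : ℕ}

/-- Engine, square-then-common type: `d = q·d₁`, `d′ = q·p²·e₁` ⇒ after `p ↦ 5` on the `z`-side (`p ≡ 5 (8)`) and `q ↦ 3` (`q ≡ 3 (8)`) the class is the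
numeric quartic `(3·5·84; 3d₁, 3·25·e₁)`. [cite: Serre1973, Ch. II §3.3 Thm 4] -/
private theorem kill_sq_common_threeFive (hq8 : q % 8 = 3) (hp8 : p % 8 = 5) {a d d' d₁ e₁ : ℤ}
    (ha : a = 84 * ((q : ℤ) * p)) (hd : d = q * d₁) (hd' : d' = (p : ℤ) ^ 2 * (q * e₁))
    (hk : ¬ ((twoIsogenyQuartic (3 * (5 * 84)) (3 * d₁) (3 * (5 ^ 2 * e₁))).map (Int.castRingHom ℚ_[2])).IsSoluble) :
    ¬ ((twoIsogenyQuartic a d d').map (Int.castRingHom ℚ_[2])).IsSoluble := fun h ↦ by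
  have h1 := isSoluble_two_of_sq_factor (n := p) (n₀ := 5) (by omega) (a₁ := 84 * q) (e₁ := q * e₁) (by rw [ha]; ring) hd' h
  exact hk (isSoluble_two_of_common_factor (n := q) (n₀ := 3) (by omega) (a₀ := 5 * 84) (d₀ := d₁) (e₀ := 5 ^ 2 * e₁) (by ring) hd
    (by ring) h1)

/-- Engine, common-factor type for the `qp`-classes: `d = qp·d₁`, `d′ = qp·e₁`, `qp ≡ 7 (mod 8)` ⇒ `qp ↦ −1` gives the numeric quartic `(−84; −d₁, −e₁)`.
[cite: Serre1973, Ch. II §3.3 Thm 4] -/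
private theorem kill_common_qp_threeFive (hq8 : q % 8 = 3) (hp8 : p % 8 = 5) {a d d' d₁ e₁ : ℤ}
    (ha : a = 84 * ((q : ℤ) * p)) (hd : d = ((q : ℤ) * p) * d₁) (hd' : d' = ((q : ℤ) * p) * e₁)
    (hk : ¬ ((twoIsogenyQuartic (-1 * 84) (-1 * d₁) (-1 * e₁)).map (Int.castRingHom ℚ_[2])).IsSoluble) :
    ¬ ((twoIsogenyQuartic a d d').map (Int.castRingHom ℚ_[2])).IsSoluble := fun h ↦ by
  have hqp8 : ((q : ℤ) * p) % 8 = 7 := by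
    have h := Nat.mul_mod q p 8
    rw [hq8, hp8] at h
    norm_num at h
    exact_mod_cast h
  exact hk (isSoluble_two_of_common_factor (n := (q : ℤ) * p) (n₀ := -1) (by omega) (a₀ := 84) (d₀ := d₁) (e₀ := e₁)
    (by rw [ha]; ring) hd hd' h)

/-- **Class `−q` of `S′`** (`d′ = 28qp²`), `(q, p) ≡ (3, 5) (mod 8)`: no `ℚ₂`-point. [cite: SilvermanAEC2009, Prop. X.4.9 and Example X.4.10] -/
theorem not_isSoluble_two_dual_negQ_threeFive (hq8 : q % 8 = 3) (hp8 : p % 8 = 5) {a d d' : ℤ} (ha : a = 84 * ((q : ℤ) * p))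
    (hd : d = -(q : ℤ)) (hd' : d' = 28 * ((q : ℤ) * p ^ 2)) :
    ¬ ((twoIsogenyQuartic a d d').map (Int.castRingHom ℚ_[2])).IsSoluble :=
  kill_sq_common_threeFive hq8 hp8 ha (d₁ := -1) (e₁ := 28) (by rw [hd]; ring) (by rw [hd']; ring)
    (by norm_num; exact not_isSoluble_two_normalised_negQ_threeFive)

/-- **Class `7q` of `S′`** (`d′ = −4qp²`), `(q, p) ≡ (3, 5) (mod 8)`: no `ℚ₂`-point. [cite: SilvermanAEC2009, Prop. X.4.9 and Example X.4.10] -/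
theorem not_isSoluble_two_dual_sevenQ_threeFive (hq8 : q % 8 = 3) (hp8 : p % 8 = 5) {a d d' : ℤ} (ha : a = 84 * ((q : ℤ) * p))
    (hd : d = 7 * (q : ℤ)) (hd' : d' = -4 * ((q : ℤ) * p ^ 2)) :
    ¬ ((twoIsogenyQuartic a d d').map (Int.castRingHom ℚ_[2])).IsSoluble :=
  kill_sq_common_threeFive hq8 hp8 ha (d₁ := 7) (e₁ := -4) (by rw [hd]; ring) (by rw [hd']; ring)
    (by norm_num; exact not_isSoluble_two_normalised_sevenQ_threeFive)

/-- **Class `−2qp` of `S′`** (`d′ = 14qp`), `(q, p) ≡ (3, 5) (mod 8)`: no `ℚ₂`-point (C7-F9a's `(−84; 2, −14)`).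
[cite: SilvermanAEC2009, Prop. X.4.9 and Example X.4.10] -/
theorem not_isSoluble_two_dual_negTwoQP_threeFive (hq8 : q % 8 = 3) (hp8 : p % 8 = 5) {a d d' : ℤ} (ha : a = 84 * ((q : ℤ) * p))
    (hd : d = -2 * ((q : ℤ) * p)) (hd' : d' = 14 * ((q : ℤ) * p)) :
    ¬ ((twoIsogenyQuartic a d d').map (Int.castRingHom ℚ_[2])).IsSoluble :=
  kill_common_qp_threeFive hq8 hp8 ha (d₁ := -2) (e₁ := 14) (by rw [hd]; ring) (by rw [hd']; ring)
    (by norm_num; exact not_isSoluble_two_normalised_pOne)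

/-- **Class `14qp` of `S′`** (`d′ = −2qp`), `(q, p) ≡ (3, 5) (mod 8)`: no `ℚ₂`-point (the `u ↔ z` swap of the previous class).
[cite: SilvermanAEC2009, Prop. X.4.9 and Example X.4.10] -/
theorem not_isSoluble_two_dual_fourteenQP_threeFive (hq8 : q % 8 = 3) (hp8 : p % 8 = 5) {a d d' : ℤ} (ha : a = 84 * ((q : ℤ) * p))
    (hd : d = 14 * ((q : ℤ) * p)) (hd' : d' = -2 * ((q : ℤ) * p)) :
    ¬ ((twoIsogenyQuartic a d d').map (Int.castRingHom ℚ_[2])).IsSoluble := by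
  rw [isSoluble_map_twoIsogenyQuartic_comm]
  exact not_isSoluble_two_dual_negTwoQP_threeFive hq8 hp8 ha hd' hd

end Classes

end Summit.BirchSwinnertonDyer.BirchSwinnertonDyer.Theorems.GoldfeldGoodTwists

end
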